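import Literature.GroupTheory.CombinatorialGroupTheory.PuncturedSurfaceGroupFiniteIndexAssembly
import Literature.GroupTheory.CombinatorialGroupTheory.RibbonGraphFaceSystems
import HarnessLib

/-!
# Finite-index subgroups of punctured surface groups, modulo the Schreier layer (GT-A mod ShapeS)

Topic `Literature/GroupTheory/CombinatorialGroupTheory`.  The assembly
`PuncturedSurfaceGroup.puncturedSurfaceGroupFiniteIndexSubgroup_of_shapes`
(`PuncturedSurfaceGroupFiniteIndexAssembly.lean`, seat abc-iut-w5-d195) reduces the named fact
`PuncturedSurfaceGroupFiniteIndexSubgroup` (Hoare–Karrass–Solitar 1971 Thm 1; ZVC LNM 835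
Thm 4.14.1) to two layers.  The NORMAL-FORM layer is now the theorem
`RibbonGraph.exists_puncturedSurfaceGroup_mulEquiv_of_faceSystem` (`RibbonGraphFaceSystems.lean`,
seat abc-iut-w5-d160: a one-vertex face system is the peripheral system of a punctured surface
group, via geometric free bases of ribbon graphs), so the fact holds modulo the SCHREIER layer alone
(`puncturedSurfaceGroupFiniteIndexSubgroup_of_schreier`): for every one-vertex face system `S` over a
finite alphabet `X` and every finite-index `K ≤ F(X)`, the one-vertex boundary system of the
Schreier ribbon graph of `K` with its cusp dictionary (the hypothesis `hS`, verbatim the statement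
seat abc-iut-w5-d186 lands as `exists_schreierRibbonGraph`).  Theorems only.

## References

* A. H. M. Hoare, A. Karrass, D. Solitar, *Subgroups of finite index of Fuchsian groups*, Math. Z.
  120 (1971) 289–298, Thm 1. [HoareKarrassSolitar1971]
* H. Zieschang, E. Vogt, H.-D. Coldewey, *Surfaces and Planar Discontinuous Groups*, LNM 835,
  Springer 1980, Thm 4.14.1, §4.14. [ZieschangVogtColdewey1980]
-/

namespace Literature.GroupTheory.CombinatorialGroupTheory.PuncturedSurfaceGroup

open List Equiv Equiv.Perm Function Subgroup

/-- **GT-A modulo the Schreier layer**: if every finite-index subgroup `K` of a free group `F(X)`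
carrying a one-vertex face system `S` has a one-vertex covering boundary system with the cusp
dictionary (`hS`), then finite-index subgroups of hyperbolic punctured surface groups are punctured
surface groups with the induced peripheral structure — the named fact
`PuncturedSurfaceGroupFiniteIndexSubgroup`; the normal-form layer is discharged by
`RibbonGraph.exists_puncturedSurfaceGroup_mulEquiv_of_faceSystem`.
[cite: ZieschangVogtColdewey1980, Thm 4.14.1 p.150] -/
theorem puncturedSurfaceGroupFiniteIndexSubgroup_of_schreier
    (hS : ∀ {X : Type} [Fintype X] [DecidableEq X]
      (S : List (List (X × Bool))), S.flatten.Nodup → (∀ x, x ∈ S.flatten) → (∀ F ∈ S, F ≠ []) →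
      (∀ x y, (sysPerm S).SameCycle x y) →
      ∀ (K : Subgroup (FreeGroup X)), K.FiniteIndex →
      ∃ (E : Type) (_ : Fintype E) (_ : DecidableEq E) (Φ : FreeGroup E ≃* K)
        (Fs : List (List (E × Bool)))
        (face : Fin Fs.length → Fin S.length) (rep : Fin Fs.length → FreeGroup X)
        (m : Fin Fs.length → ℕ),
        Fs.flatten.Nodup ∧ (∀ l, l ∈ Fs.flatten) ∧ (∀ W ∈ Fs, W ≠ []) ∧
        (∀ l l', (sysPerm Fs).SameCycle l l') ∧
        Fintype.card E + K.index = K.index * Fintype.card X + 1 ∧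
        (∀ i, 0 < m i ∧
          ((Φ (FreeGroup.mk (Fs.get i)) : FreeGroup X) =
            rep i * FreeGroup.mk (S.get (face i)) ^ (m i) * (rep i)⁻¹) ∧
          (∀ n : ℤ, rep i * FreeGroup.mk (S.get (face i)) ^ n * (rep i)⁻¹ ∈ K ↔ (m i : ℤ) ∣ n)) ∧
        (∀ (f : Fin S.length) (δ : FreeGroup X), ∃! i : Fin Fs.length, face i = f ∧
          ∃ k ∈ K, ∃ z ∈ Subgroup.zpowers (FreeGroup.mk (S.get f)), rep i = k * δ * z)) :
    Literature.GroupTheory.CombinatorialGroupTheory.PuncturedSurfaceGroupFiniteIndexSubgroup :=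
  puncturedSurfaceGroupFiniteIndexSubgroup_of_shapes hS fun Fs h0 hd hc hne htr =>
    RibbonGraph.exists_puncturedSurfaceGroup_mulEquiv_of_faceSystem Fs h0 hd hc hne htr

end Literature.GroupTheory.CombinatorialGroupTheory.PuncturedSurfaceGroup
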